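import Summits.QuantumFields.YangMills.Theses.RevelationMartingale

/-!
# Route RevelationMartingale — the bond-revelation filtration (mechanism-specific form of the deciding crux)

LINE 13's lever is a SPATIAL REVELATION (Doob) martingale: the finest-level bond variables `U(b)`, `b ∈ PBond (F.P K) 0`,
are revealed one at a time along an enumeration `e : Fin N → PBond (F.P K) 0`; `ℱ_i` is the σ-algebra generated by the
first `i` revealed bonds, i.e. the pull-back of the product σ-algebra under the masked revelation map
`U ↦ (m ↦ if m < i then U (e m) else 1)`.  This file proves: such a filtration exists (`exists_bondFiltration`), it starts
at `⊥`, every measurable observable is `ℱ_N`-measurable once `e` is onto, and the MECHANISM-SPECIFIC form of the route's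
deciding crux `SubGaussianRevelationL` (filtration pinned to a bond revelation) implies it —
`revelationMartingale_subGaussianRevelationL_of_bondRevelation`, the composition used by LINE 13's registered skeleton.
No definitions (statements stay over existing declarations); no summit and no rung is proved here. [folklore]
-/

namespace Summit.QuantumFields.YangMills.Theorems

open scoped BigOperators Classical MeasureTheory
open MeasureTheory Literature.MathematicalPhysics.QuantumFieldTheory.Balaban1983to89
  Literature.MathematicalPhysics.QuantumFieldTheory.Balaban1983to89.T3ContinuumYM3Torus

section BondFiltration

variable {P : Params} {G : Type*} [GaugeGroup G] [MeasurableSpace G]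

/-- The masked revelation map `U ↦ (m ↦ if m < i then U (e m) else 1)` is measurable. [folklore] -/
theorem measurable_bondReveal {N : ℕ} (e : Fin N → PBond P 0) (i : ℕ) :
    Measurable (fun (U : GaugeField P 0 G) (m : Fin N) => if (m : ℕ) < i then U (e m) else (1 : G)) := by
  refine measurable_pi_lambda _ fun m => ?_
  by_cases h : (m : ℕ) < i
  · simp only [h, if_true]; exact measurable_pi_apply (e m)
  · simp only [h, if_false]; exact measurable_const

/-- Revealing more bonds generates a larger σ-algebra. [folklore] -/
theorem bondReveal_comap_mono {N : ℕ} (e : Fin N → PBond P 0) :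
    Monotone (fun i : ℕ => MeasurableSpace.comap
      (fun (U : GaugeField P 0 G) (m : Fin N) => if (m : ℕ) < i then U (e m) else (1 : G)) inferInstance) := by
  intro i k hik
  have hmask : Measurable (fun v : Fin N → G => fun m : Fin N => if (m : ℕ) < i then v m else 1) := by
    refine measurable_pi_lambda _ fun m => ?_
    by_cases h : (m : ℕ) < i
    · simp only [h, if_true]; exact measurable_pi_apply m
    · simp only [h, if_false]; exact measurable_const
  have hcomp : (fun (U : GaugeField P 0 G) (m : Fin N) => if (m : ℕ) < i then U (e m) else (1 : G)) =
      (fun v : Fin N → G => fun m : Fin N => if (m : ℕ) < i then v m else 1) ∘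
        (fun (U : GaugeField P 0 G) (m : Fin N) => if (m : ℕ) < k then U (e m) else (1 : G)) := by
    funext U m
    simp only [Function.comp_apply]
    by_cases h1 : (m : ℕ) < i
    · have h2 : (m : ℕ) < k := lt_of_lt_of_le h1 hik
      simp [h1, h2]
    · simp [h1]
  show MeasurableSpace.comap _ _ ≤ MeasurableSpace.comap _ _
  rw [hcomp, ← MeasurableSpace.comap_comp]
  exact MeasurableSpace.comap_mono hmask.comap_le

/-- The bond-revelation filtration of an enumeration `e` of finest-level bonds EXISTS (as a `Filtration`). [folklore] -/
theorem exists_bondFiltration {N : ℕ} (e : Fin N → PBond P 0) :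
    ∃ ℱ : MeasureTheory.Filtration ℕ (inferInstance : MeasurableSpace (GaugeField P 0 G)),
      ∀ i, ℱ i = MeasurableSpace.comap
        (fun (U : GaugeField P 0 G) (m : Fin N) => if (m : ℕ) < i then U (e m) else (1 : G)) inferInstance :=
  ⟨{ seq := fun i => MeasurableSpace.comap
        (fun (U : GaugeField P 0 G) (m : Fin N) => if (m : ℕ) < i then U (e m) else (1 : G)) inferInstance
     mono' := bondReveal_comap_mono e
     le' := fun i => (measurable_bondReveal e i).comap_le }, fun _ => rfl⟩

/-- Nothing revealed: the level-`0` σ-algebra is `⊥`. [folklore] -/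
theorem bondReveal_comap_zero {N : ℕ} (e : Fin N → PBond P 0) :
    MeasurableSpace.comap
      (fun (U : GaugeField P 0 G) (m : Fin N) => if (m : ℕ) < 0 then U (e m) else (1 : G)) inferInstance =
      (⊥ : MeasurableSpace (GaugeField P 0 G)) := by
  have h : (fun (U : GaugeField P 0 G) (m : Fin N) => if (m : ℕ) < 0 then U (e m) else (1 : G)) =
      fun _ => fun _ => (1 : G) := by
    funext U m; simp
  rw [h]; exact MeasurableSpace.comap_const _

/-- Everything revealed: once `e` is onto, every measurable observable is `ℱ_N`-measurable. [folklore] -/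
theorem measurable_bondReveal_comap_top {N : ℕ} (e : Fin N → PBond P 0) (he : Function.Surjective e)
    {f : GaugeField P 0 G → ℝ} (hf : Measurable f) :
    Measurable[MeasurableSpace.comap
      (fun (U : GaugeField P 0 G) (m : Fin N) => if (m : ℕ) < N then U (e m) else (1 : G)) inferInstance] f := by
  obtain ⟨s, hs⟩ := he.hasRightInverse
  have hrec : f = (fun v : Fin N → G => f (fun b => v (s b))) ∘
      (fun (U : GaugeField P 0 G) (m : Fin N) => if (m : ℕ) < N then U (e m) else (1 : G)) := by
    funext U
    simp only [Function.comp_apply, Fin.is_lt, if_true]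
    congr 1; funext b; rw [hs b]
  have hg : Measurable (fun v : Fin N → G => f (fun b => v (s b))) :=
    hf.comp (measurable_pi_lambda _ fun b => measurable_pi_apply (s b))
  rw [hrec]
  exact hg.comp (measurable_iff_comap_le.mpr le_rfl)

end BondFiltration

/-- The observable `dist1(Ū^j(∂p))` is measurable. [folklore] -/
theorem measurable_dist1_iter_plaqHol (F : T3Family) (K j : ℕ) (p : Plaq (F.P K) j) :
    Measurable fun U : GaugeField (F.P K) 0 (Matrix.specialUnitaryGroup (Fin 2) ℂ) =>
      GaugeGroup.dist1 (GaugeField.plaqHol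
        (Averaging.iter (fun i => BlockAveraging.blockAvg (P := F.P K) (j := i) T3UnitLawDensityEML.ℰp) j U) p) :=
  RegularGaugeGroup.measurable_dist1.comp ((Missing.measurable_plaqHol p).comp
    (T4Continuum.measurable_iter _
      (F.avgMeasurable_of_measurableE T3UnitLawDensityEML.ℰp T3UnitLawDensityEML.measurableE_ℰp K) j))

/-- MECHANISM-SPECIFIC FORM ⇒ DECIDING CRUX.  If, at every `(F, γ ≤ γ₁, K, 1 ≤ j ≤ K, p)`, along SOME enumeration `e` of
the finest bonds (onto), for THE filtration `ℱ` that is the bond revelation of `e` (`ℱ i` = pull-back under the masked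
revelation map; it exists: `exists_bondFiltration`), the Doob increments of `dist1(Ū^j(∂p))` are conditionally sub-Gaussian with adapted proxies `σ_i ≥ 0`
summing to `≤ Cv·g_(K−j)²` on the first-exit window, then the route's deciding crux `SubGaussianRevelationL` holds. [folklore] -/
theorem revelationMartingale_subGaussianRevelationL_of_bondRevelation
    (h : ∀ (L : ℕ) (b₀ p₀ b₂ : ℝ), 0 < b₀ → 2 < p₀ → b₀ ≤ b₂ → ∃ (γ₁ Cv : ℝ), 0 < γ₁ ∧ γ₁ ≤ 1 ∧ 0 < Cv ∧
      ∀ (F : T3Family) (γ : ℝ), F.L = L → 0 < γ → γ ≤ γ₁ → ∀ (K j : ℕ), 1 ≤ j → j ≤ K → ∀ p : Plaq (F.P K) j,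
      ∃ (N : ℕ) (e : Fin N → PBond (F.P K) 0), Function.Surjective e ∧
        ∀ ℱ : MeasureTheory.Filtration ℕ
            (inferInstance : MeasurableSpace (GaugeField (F.P K) 0 (Matrix.specialUnitaryGroup (Fin 2) ℂ))),
          (∀ i, ℱ i = MeasurableSpace.comap
            (fun (U : GaugeField (F.P K) 0 (Matrix.specialUnitaryGroup (Fin 2) ℂ)) (m : Fin N) =>
              if (m : ℕ) < i then U (e m) else (1 : Matrix.specialUnitaryGroup (Fin 2) ℂ)) inferInstance) →
        ∃ σ : ℕ → GaugeField (F.P K) 0 (Matrix.specialUnitaryGroup (Fin 2) ℂ) → ℝ,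
          (∀ i, StronglyMeasurable[ℱ i] (σ i)) ∧
          (∀ i U, 0 ≤ σ i U) ∧
          (∀ (i : ℕ) (s : ℝ), ∀ᵐ U ∂(T3UnitScaleTilt.gibbsK F T3UnitLawDensityEML.ℰp γ K),
            MeasureTheory.condExp (ℱ i) (T3UnitScaleTilt.gibbsK F T3UnitLawDensityEML.ℰp γ K)
              (fun U' => Real.exp (s *
                (MeasureTheory.condExp (ℱ (i + 1)) (T3UnitScaleTilt.gibbsK F T3UnitLawDensityEML.ℰp γ K)
                    (fun V => GaugeGroup.dist1 (GaugeField.plaqHol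
                      (Averaging.iter (fun i => BlockAveraging.blockAvg (P := F.P K) (j := i) T3UnitLawDensityEML.ℰp) j V) p)) U' -
                 MeasureTheory.condExp (ℱ i) (T3UnitScaleTilt.gibbsK F T3UnitLawDensityEML.ℰp γ K)
                    (fun V => GaugeGroup.dist1 (GaugeField.plaqHol
                      (Averaging.iter (fun i => BlockAveraging.blockAvg (P := F.P K) (j := i) T3UnitLawDensityEML.ℰp) j V) p)) U'))) U
              ≤ Real.exp (s ^ 2 * σ i U / 2)) ∧
          (∀ᵐ U ∂(T3UnitScaleTilt.gibbsK F T3UnitLawDensityEML.ℰp γ K),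
            ((∀ k, k < j → PlaqSmall (T3UnitScaleTilt.θBal F.L γ b₀ p₀ (K - k))
                (Averaging.iter (fun i => BlockAveraging.blockAvg (P := F.P K) (j := i) T3UnitLawDensityEML.ℰp) k U)) ∧
              PlaqSmall (T3UnitScaleTilt.θBal F.L γ b₂ p₀ (K - j))
                (Averaging.iter (fun i => BlockAveraging.blockAvg (P := F.P K) (j := i) T3UnitLawDensityEML.ℰp) j U)) →
            ∑ i ∈ Finset.range N, σ i U ≤ Cv * (γ * ((F.L : ℝ)⁻¹) ^ (K - j)))) :
    Summit.QuantumFields.YangMills.Theses.RevelationMartingale.SubGaussianRevelationL := by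
  intro L b₀ p₀ b₂ hb₀ hp₀ hb₂
  obtain ⟨γ₁, Cv, hγ₁, hγ₁1, hCv, hF⟩ := h L b₀ p₀ b₂ hb₀ hp₀ hb₂
  refine ⟨γ₁, Cv, hγ₁, hγ₁1, hCv, fun F γ hL hγ hγle K j hj hjK p => ?_⟩
  obtain ⟨N, e, he, hAll⟩ := hF F γ hL hγ hγle K j hj hjK p
  obtain ⟨ℱ, hℱ⟩ := exists_bondFiltration (G := Matrix.specialUnitaryGroup (Fin 2) ℂ) e
  obtain ⟨σ, hσm, hσ0, hmgf, hwin⟩ := hAll ℱ hℱ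
  have h0 : ℱ 0 = (⊥ : MeasurableSpace (GaugeField (F.P K) 0 (Matrix.specialUnitaryGroup (Fin 2) ℂ))) := by
    rw [hℱ 0]; exact bondReveal_comap_zero e
  have hN : StronglyMeasurable[ℱ N] (fun U : GaugeField (F.P K) 0 (Matrix.specialUnitaryGroup (Fin 2) ℂ) =>
      GaugeGroup.dist1 (GaugeField.plaqHol
        (Averaging.iter (fun i => BlockAveraging.blockAvg (P := F.P K) (j := i) T3UnitLawDensityEML.ℰp) j U) p)) := by
    have hm := measurable_bondReveal_comap_top e he (measurable_dist1_iter_plaqHol F K j p)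
    rw [← hℱ N] at hm
    exact hm.stronglyMeasurable
  exact ⟨ℱ, N, σ, h0, hN, hσm, hσ0, hmgf, hwin⟩

end Summit.QuantumFields.YangMills.Theorems
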